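import Mathlib
import Summits.Ventures.PercRepro2.K5HyperB

/-!
# THE `TvT` CERTIFICATES OF THE (i) SIDE AT the coincidence `o = b` (marking `b = 0`), PART A
(blind cell PercRepro2, typer-1 g12; mine-1 §23.1 / §23.5 at the coincidence markings of `K₅`; twin `k5hyper_b_twin.py i 0`,
kit job j246854)

One `decide +kernel` per comparison under `maxHeartbeats 0` (the g10 rules: bit tables, import-light certificate files).
-/

namespace Summit.Ventures.PercRepro2

namespace K5

set_option maxRecDepth 100000 in
set_option maxHeartbeats 0 in
/-- `TvT-(i) ≥ 0` at the marking `b = 0` on the triangle `T = {0, 1, 2}`. -/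
theorem cert_TvTIB0_012 :
    CertLE (kNegTvTIB 0 0 1 2) (kPosTvTIB 0 0 1 2) := by
  unfold CertLE
  decide +kernel

set_option maxRecDepth 100000 in
set_option maxHeartbeats 0 in
/-- `TvT-(i) ≥ 0` at the marking `b = 0` on the triangle `T = {0, 1, 3}`. -/
theorem cert_TvTIB0_013 :
    CertLE (kNegTvTIB 0 0 1 3) (kPosTvTIB 0 0 1 3) := by
  unfold CertLE
  decide +kernel

set_option maxRecDepth 100000 in
set_option maxHeartbeats 0 in
/-- `TvT-(i) ≥ 0` at the marking `b = 0` on the triangle `T = {0, 1, 4}`. -/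
theorem cert_TvTIB0_014 :
    CertLE (kNegTvTIB 0 0 1 4) (kPosTvTIB 0 0 1 4) := by
  unfold CertLE
  decide +kernel

set_option maxRecDepth 100000 in
set_option maxHeartbeats 0 in
/-- `TvT-(i) ≥ 0` at the marking `b = 0` on the triangle `T = {0, 2, 3}`. -/
theorem cert_TvTIB0_023 :
    CertLE (kNegTvTIB 0 0 2 3) (kPosTvTIB 0 0 2 3) := by
  unfold CertLE
  decide +kernel

end K5

end Summit.Ventures.PercRepro2
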